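import Literature.Analysis.Distribution.PeanoKernelPointValue
import Mathlib.MeasureTheory.Group.Integral
import Mathlib.Analysis.Calculus.Deriv.Shift
import HarnessLib

/-!
# Restriction estimate for weak solutions of an autonomous evolution equation (Hörmander, Thm. 4.4.8, estimate form)

Topic `Literature/Analysis/Distribution`; namespace `Literature.Analysis.Distribution`. Theorems only.
Sequel of `PeanoKernelPointValue`.

Let `w : ℝ → 𝒯 → E` be a family of "pairings" `w t F` (think: `w t F = ∫ W(t, x) F(x) dx` for a
smooth function `W` of a transversal variable `t` and tangential variables `x`, and test functions
`F` in `x`), with values in a real Banach space `E`, such that each `t ↦ w t F` is smooth and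
satisfies the AUTONOMOUS EVOLUTION EQUATION

  `d/dt (w t F) = w t (M F)`

for one map `M : 𝒯 → 𝒯` (the transpose of a `t`-independent differential operator in `x`; no
linearity is needed). Suppose the only available bound is WEAK in `t` of order `d`: for every smooth
real `η` supported in `[-1, 3]` with `|η|, …, |η^{(d)}| ≤ B`,

  `‖∫ η(t) • w t F dt‖ ≤ A · q(F) · B`

for some size function `q ≥ 0` on `𝒯`. Then the RESTRICTION to `t = 0` is bounded:

  `‖w 0 F‖ ≤ C_d · A · (q F + q (M^{d+2} F))`  (`exists_norm_apply_zero_le_of_weak_evolution`),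

with the constant `C_d` of `PeanoKernelPointValue.exists_norm_apply_zero_le_of_weak_bounds`: indeed
`(t ↦ w t F)^{(j)} = t ↦ w t (M^j F)` (`iteratedDeriv_eq_of_deriv_eq`), so the weak bounds for `F`
and for `M^{d+2} F` are exactly the two hypotheses of the Peano-kernel estimate. This is the
quantitative content of Hörmander's theorem that a distribution satisfying `∂_t u = a(x, ∂_x) u` is a
smooth function of `t` with values in `𝒟'` — hence restricts to `t = 0` — in the autonomous case
(Hörmander, ALPDO I, Thm. 4.4.8, Thm. 4.4.8′), which is the case of restriction along one-parameter
subgroups: for the Whittaker distribution `W(g) = ℓ(τ(g) w)` of a unitary representation and a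
transversal one-parameter subgroup `t ↦ e^{tB}` of the mirabolic subgroup `P`, the Casimir–Whittaker
reduction of the letter `B` makes `t ↦ ∫_P F(p) W(p e^{tB} q) dp` such a family with `M` the
transpose of a left-invariant differential operator on `P` (automatic continuity of Whittaker
functionals, Jacquet–Shalika (1981), Prop. (3.8), all ranks). Iterating over a basis of transversal
directions restricts `W` to `P`.

## References

* L. Hörmander, *The Analysis of Linear Partial Differential Operators I*, 2nd ed., Springer
  (1990/2003), Thm. 4.4.8, Thm. 4.4.8′ [HormanderALPDO1].
* H. Jacquet, J. A. Shalika, *On Euler products and the classification of automorphic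
  representations I*, Amer. J. Math. 103 (1981), §3, Prop. (3.8) [JacquetShalikaAJM1981].
-/

noncomputable section

open scoped ContDiff Topology
open _root_.MeasureTheory _root_.Filter _root_.Set

namespace Literature.Analysis.Distribution

variable {E : Type*} [NormedAddCommGroup E] [NormedSpace ℝ E] {𝒯 : Type*}

/-- **Derivatives of a weak solution of an autonomous evolution equation**: if
`d/dt (w t F) = w t (M F)` for all `F` and `t`, then `(t ↦ w t F)^{(j)} = t ↦ w t (M^j F)`.
[folklore] -/
theorem iteratedDeriv_eq_of_deriv_eq (w : ℝ → 𝒯 → E) (M : 𝒯 → 𝒯)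
    (hderiv : ∀ F t, deriv (fun s => w s F) t = w t (M F)) :
    ∀ (j : ℕ) (F : 𝒯), iteratedDeriv j (fun t => w t F) = fun t => w t (M^[j] F)
  | 0, F => by simp
  | j + 1, F => by
    rw [iteratedDeriv_succ, iteratedDeriv_eq_of_deriv_eq w M hderiv j F]
    funext t
    rw [hderiv (M^[j] F) t, ← Function.iterate_succ_apply' M j F]

variable [CompleteSpace E]

/-- **Restriction estimate for weak solutions of an autonomous evolution equation (Hörmander,
Thm. 4.4.8, in estimate form).** For every `d` there is `C = C(d) ≥ 0` such that: if each
`t ↦ w t F` is smooth with `d/dt (w t F) = w t (M F)`, and for all smooth real `η` supported in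
`[-1, 3]` with `|η^{(i)}| ≤ B` (`i ≤ d`) the weak bound `‖∫ η • w · F‖ ≤ A · q(F) · B` holds
(`q ≥ 0`, `A ≥ 0`), then `‖w 0 F‖ ≤ C · A · (q F + q (M^{d+2} F))` for every `F`.
[cite: HormanderALPDO1, Thm. 4.4.8] -/
theorem exists_norm_apply_zero_le_of_weak_evolution (d : ℕ) :
    ∃ C : ℝ, 0 ≤ C ∧ ∀ (w : ℝ → 𝒯 → E) (M : 𝒯 → 𝒯) (q : 𝒯 → ℝ) (A : ℝ),
      0 ≤ A → (∀ F, 0 ≤ q F) →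
      (∀ F, ContDiff ℝ ∞ (fun t => w t F)) →
      (∀ F t, deriv (fun s => w s F) t = w t (M F)) →
      (∀ (F : 𝒯) (η : ℝ → ℝ), ContDiff ℝ ∞ η → tsupport η ⊆ Icc (-1) 3 →
          ∀ B : ℝ, (∀ i ≤ d, ∀ t, |iteratedDeriv i η t| ≤ B) →
            ‖∫ t, η t • w t F‖ ≤ A * q F * B) →
      ∀ F : 𝒯, ‖w 0 F‖ ≤ C * A * (q F + q (M^[d + 2] F)) := by
  obtain ⟨C, hC0, hC⟩ := exists_norm_apply_zero_le_of_weak_bounds (E := E) d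
  refine ⟨C, hC0, fun w M q A hA hq hsmooth hderiv hweak F => ?_⟩
  have hiter := iteratedDeriv_eq_of_deriv_eq w M hderiv
  set A' : ℝ := A * (q F + q (M^[d + 2] F)) with hA'
  have hmain := hC (fun t => w t F) (hsmooth F) A'
    (fun η hη hsupp B hB => ?_) (fun η hη hsupp B hB => ?_)
  · calc ‖w 0 F‖ ≤ C * A' := hmain
      _ = C * A * (q F + q (M^[d + 2] F)) := by rw [hA']; ring
  · -- weak bound for `g = w · F`
    have hB0 : 0 ≤ B := (abs_nonneg _).trans (hB 0 (Nat.zero_le _) 0)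
    calc ‖∫ t, η t • w t F‖ ≤ A * q F * B := hweak F η hη hsupp B hB
      _ ≤ A' * B := by
          rw [hA']
          refine mul_le_mul_of_nonneg_right ?_ hB0
          exact mul_le_mul_of_nonneg_left (le_add_of_nonneg_right (hq _)) hA
  · -- weak bound for `g^{(d+2)} = w · (M^{d+2} F)`
    have hB0 : 0 ≤ B := (abs_nonneg _).trans (hB 0 (Nat.zero_le _) 0)
    rw [hiter (d + 2) F]
    calc ‖∫ t, η t • w t (M^[d + 2] F)‖ ≤ A * q (M^[d + 2] F) * B :=
          hweak (M^[d + 2] F) η hη hsupp B hB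
      _ ≤ A' * B := by
          rw [hA']
          refine mul_le_mul_of_nonneg_right ?_ hB0
          exact mul_le_mul_of_nonneg_left (le_add_of_nonneg_left (hq _)) hA

/-- **Translated form**: the same estimate at any point `t₀`, for bounds that are weak on
`[t₀ - 1, t₀ + 3]` (apply the previous theorem to `t ↦ w (t₀ + t)`). [cite: HormanderALPDO1, Thm. 4.4.8] -/
theorem exists_norm_apply_le_of_weak_evolution (d : ℕ) :
    ∃ C : ℝ, 0 ≤ C ∧ ∀ (w : ℝ → 𝒯 → E) (M : 𝒯 → 𝒯) (q : 𝒯 → ℝ) (A t₀ : ℝ),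
      0 ≤ A → (∀ F, 0 ≤ q F) →
      (∀ F, ContDiff ℝ ∞ (fun t => w t F)) →
      (∀ F t, deriv (fun s => w s F) t = w t (M F)) →
      (∀ (F : 𝒯) (η : ℝ → ℝ), ContDiff ℝ ∞ η → tsupport η ⊆ Icc (t₀ - 1) (t₀ + 3) →
          ∀ B : ℝ, (∀ i ≤ d, ∀ t, |iteratedDeriv i η t| ≤ B) →
            ‖∫ t, η t • w t F‖ ≤ A * q F * B) →
      ∀ F : 𝒯, ‖w t₀ F‖ ≤ C * A * (q F + q (M^[d + 2] F)) := by
  obtain ⟨C, hC0, hC⟩ := exists_norm_apply_zero_le_of_weak_evolution (E := E) (𝒯 := 𝒯) d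
  refine ⟨C, hC0, fun w M q A t₀ hA hq hsmooth hderiv hweak F => ?_⟩
  -- the translated family
  set w' : ℝ → 𝒯 → E := fun t F => w (t₀ + t) F with hw'
  have hsmooth' : ∀ F, ContDiff ℝ ∞ (fun t => w' t F) := fun F =>
    (hsmooth F).comp (contDiff_const.add contDiff_id)
  have hderiv' : ∀ F t, deriv (fun s => w' s F) t = w' t (M F) := by
    intro F t
    simp only [hw']
    rw [deriv_comp_const_add (fun s => w s F) t₀ t, hderiv F (t₀ + t)]
  have hweak' : ∀ (F : 𝒯) (η : ℝ → ℝ), ContDiff ℝ ∞ η → tsupport η ⊆ Icc (-1) 3 →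
      ∀ B : ℝ, (∀ i ≤ d, ∀ t, |iteratedDeriv i η t| ≤ B) → ‖∫ t, η t • w' t F‖ ≤ A * q F * B := by
    intro F η hη hsupp B hB
    -- `∫ η(t) • w (t₀ + t) F dt = ∫ η(s - t₀) • w s F ds`
    have hshift : ∫ t, η t • w' t F = ∫ s, η (s - t₀) • w s F := by
      rw [← integral_add_right_eq_self (μ := volume) (fun s => η (s - t₀) • w s F) t₀]
      refine integral_congr_ae (Eventually.of_forall fun t => ?_)
      simp [hw', add_comm]
    rw [hshift]
    refine hweak F (fun s => η (s - t₀)) (hη.comp (contDiff_id.sub contDiff_const)) ?_ B ?_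
    · -- support of the translate
      refine closure_minimal (fun s hs => ?_) isClosed_Icc
      rw [Function.mem_support] at hs
      have hs' : s - t₀ ∈ tsupport η := subset_tsupport _ (Function.mem_support.2 hs)
      have := hsupp hs'
      constructor <;> linarith [this.1, this.2]
    · intro i hi s
      rw [iteratedDeriv_comp_sub_const]
      exact hB i hi _
  simpa [hw'] using hC w' M q A hA hq hsmooth' hderiv' hweak' F

end Literature.Analysis.Distribution
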